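import Summits.CriticalPhenomena.PercolationContinuityZ3.Theorems.Transplant.PlanarSkeletonFrmRayStrict
import Summits.CriticalPhenomena.PercolationContinuityZ3.Theorems.Transplant.SkelSignHoldsAll
import HarnessLib

/-!
# Φ2 at the interface level, XVIII: THE PAYOFF — every `PlanarSkeletonSign` carrier (ANY number of types) has `θ_v(p_c) = 0` UNCONDITIONALLY;
# the multi-type `{±1}` node's rows lose their Φ2 hypothesis

builds on p205010 (kernel theorem, internal audit signed; external expert review pending): the unconditional theorems of this file run through the
CLOSED multi-type D″ node `samePDropOfSkeletonSign_holds` (`SkelSignHoldsAll`), whose proof uses near-one gluing (AdditiveGluing), which builds on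
p205010.  Nothing here is a claim about the OPEN nodes (`SamePDropOfSkeletonNeg` multi-type, `SamePDropOfSkeletonFrm₁`); rows through them are
CONDITIONAL and say so in their signatures.
Lane `prim-bschramm`, seat `prim-bschramm-p4` gen 15 (PART C3 of `P4-GENERAL.md`, §37).  Helper file
(`--supports stmt-CriticalPhenomena-4575 --as helper`).

Until now a multi-type D″ customer supplied TWO inputs: a `PlanarSkeletonSign` AND subcritical cylinders at `p_c` (Φ2 — discharged case by case:
tubes of `X □ ℤ^d`, centralised translations, thick frames on Cayley graphs, stacked lattices).  File XVII made Φ2 a theorem of the bare interface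
(`PlanarSkeletonFrm.cylSubcritical_criticalProb_ray`, any number of types), so:
* **`PlanarSkeletonSign.criticalContinuity_skeleton_only`**: a locally finite graph carrying a `PlanarSkeletonSign` — a sup-norm 1-Lipschitz
  `φ : V → ℤ²`, finitely many base vertices with transitive translating frames, a degree bound, outward unit steps, connected cylinders, and at
  each base vertex a central inversion and an axis flip — has `θ_v(p_c) = 0` at EVERY vertex, UNCONDITIONALLY; the skeleton is the ONLY input;
* `PlanarSkeletonConc.criticalContinuity_skeleton_only`: the same for the `D₄` interface (forget the rest of the point group);
* `samePDropOfSkeletonSign_minimal_skeleton_only`: the closed node restated without Φ2;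
* `PlanarSkeletonNeg.criticalContinuity_of_negNode`: for the OPEN multi-type `{±1}` node, the conditional row now reads "skeleton ⟹ θ_v(p_c) = 0"
  with no Φ2, no `p_c < 1`, no uniqueness, no growth hypothesis.
INPUT(G) of record for the whole D″ class (any number of types) is now the skeleton ALONE — nothing about percolation on sub-structures.
[cite: BenjaminiSchramm1996, Conj. 4] [cite: AizenmanGrimmett1991, Thm 1 (essential enhancements)] [cite: KozmaNitzan2024, §1 p. 2 (approach 1); §4 pp. 15–16]
-/

noncomputable section

namespace Summit.CriticalPhenomena.PercolationContinuityZ3.Theorems.Transplant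

open MeasureTheory SimpleGraph Literature.Probability.LatticeModels Literature.Probability.Percolation
open Literature.Barriers.CriticalPhenomena (countable_of_connected_of_locallyFinite)
open scoped Classical

variable {V : Type} {G : SimpleGraph V} [G.LocallyFinite]

/-- **Φ2 at `p_c` for every `PlanarSkeletonNeg`** (any number of types): transport of `PlanarSkeletonFrm.cylSubcritical_criticalProb_ray`
through the forgetful map. [cite: AizenmanGrimmett1991, Thm 1 (essential enhancements)] -/
theorem PlanarSkeletonNeg.cylSubcritical_criticalProb_ray (Φ : PlanarSkeletonNeg G) (t₀ : V) : Φ.CylSubcritical (criticalProbIOf G t₀) :=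
  (Φ.cylSubcritical_toFrm_iff _).1 (Φ.toFrm.cylSubcritical_criticalProb_ray t₀)

/-- **THEOREM (unconditional).  A locally finite graph carrying a `PlanarSkeletonSign` — ANY finite number of base-vertex types — has
`θ_v(p_c) = 0` at EVERY vertex**; the skeleton is the only input (Φ2, `p_c < 1`, connectedness, quasi-transitivity, uniqueness are derived).
builds on p205010 (kernel theorem, internal audit signed; external expert review pending).
[cite: BenjaminiSchramm1996, Conj. 4] [cite: KozmaNitzan2024, §1 p. 2 (approach 1)] [cite: AizenmanGrimmett1991, Thm 1] -/
theorem PlanarSkeletonSign.criticalContinuity_skeleton_only (Φ : PlanarSkeletonSign G) (v : V) : theta G v (criticalProbIOf G v) = 0 :=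
  PlanarSkeletonSign.criticalContinuity' G Φ (fun t _ => Φ.toPlanarSkeletonNeg.cylSubcritical_criticalProb_ray t) v

/-- **The same for the `D₄` interface `PlanarSkeletonConc`** (forget all of the point group but the inversion and one flip).
builds on p205010 (kernel theorem, internal audit signed; external expert review pending). [cite: BenjaminiSchramm1996, Conj. 4] -/
theorem PlanarSkeletonConc.criticalContinuity_skeleton_only (Φ : PlanarSkeletonConc G) (v : V) : theta G v (criticalProbIOf G v) = 0 :=
  Φ.toSign.criticalContinuity_skeleton_only v

/-- **The closed multi-type D″ node restated WITHOUT Φ2**: `θ_t(p_c) = 0` at every base vertex of every `PlanarSkeletonSign` graph.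
builds on p205010 (kernel theorem, internal audit signed; external expert review pending). [cite: BenjaminiSchramm1996, Conj. 4] -/
theorem samePDropOfSkeletonSign_minimal_skeleton_only {V : Type} (G : SimpleGraph V) [G.LocallyFinite] (Φ : PlanarSkeletonSign G)
    (t : V) (_ht : t ∈ Φ.types) : theta G t (criticalProbIOf G t) = 0 :=
  Φ.criticalContinuity_skeleton_only t

/-- **Conditional row of the OPEN multi-type `{±1}` node, with NO Φ2 hypothesis**: if `SamePDropOfSkeletonNeg` holds then every locally finite
graph carrying a `PlanarSkeletonNeg` (any number of types) has `θ_v(p_c) = 0` at every vertex — connectedness, quasi-transitivity, `p_c < 1` and Φ2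
are supplied by the skeleton, uniqueness by Hutchcroft / Burton–Keane.  Nothing is claimed about the node.
[cite: BenjaminiSchramm1996, Conj. 4] [cite: Hutchcroft2016, Thm. 1] [cite: LyonsPeres2016, Thm. 7.6] -/
theorem PlanarSkeletonNeg.criticalContinuity_of_negNode (hD : SamePDropOfSkeletonNeg) (Φ : PlanarSkeletonNeg G) (v : V) :
    theta G v (criticalProbIOf G v) = 0 := by
  haveI : Countable V := countable_of_connected_of_locallyFinite G (Φ.toFrm.graph_connected v) v
  obtain ⟨t, ht, α, hαv, -⟩ := Φ.frame v
  have hbase : theta G t (criticalProbIOf G t) = 0 :=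
    continuity_of_skeletonNeg_drop_qt hD G Φ (Φ.toFrm.graph_connected t) Φ.isQuasiTransitive t ht (Φ.toFrm.criticalProb_lt_one t)
      (Φ.cylSubcritical_criticalProb_ray t)
  have hθ := theta_iso α t (criticalProbIOf G t)
  have hpc := criticalProb_iso α t
  rw [hαv] at hθ hpc
  have e : criticalProbIOf G v = criticalProbIOf G t := Subtype.ext hpc
  rw [e, hθ]
  exact hbase

/-- **Normal form of the open multi-type `{±1}` node WITHOUT Φ2**: `SamePDropOfSkeletonNeg` holds iff every `PlanarSkeletonNeg` graph has
`θ_t(p_c) = 0` at its base vertices — the cylinder hypothesis has left the statement. [cite: BenjaminiSchramm1996, Conj. 4] -/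
theorem samePDropOfSkeletonNeg_iff_skeleton_only : SamePDropOfSkeletonNeg ↔
    ∀ {V : Type} (G : SimpleGraph V) [G.LocallyFinite] (Φ : PlanarSkeletonNeg G), ∀ t ∈ Φ.types, theta G t (criticalProbIOf G t) = 0 := by
  constructor
  · intro hD V G _ Φ t _
    exact Φ.criticalContinuity_of_negNode hD t
  · intro h
    refine samePDropOfSkeletonNeg_iff_critical.2 fun G _ Φ _ t ht _ _ _ => ?_
    exact h G Φ t ht

end Summit.CriticalPhenomena.PercolationContinuityZ3.Theorems.Transplant

end
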